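import Mathlib
import Summits.KontsevichZagierPeriods.KontsevichZagierPeriods.Theorems.ZagierDilogarithmConjecture.Negative.DehnInvariant
import Summits.KontsevichZagierPeriods.KontsevichZagierPeriods.Theorems.HyperbolicBlochZagierDilogarithmConjectureDehnRigidity
import HarnessLib

/-!
# `ZagierDilogarithmConjecture` (stmt-KontsevichZagierPeriods-10550) — line `kummer-clausen-linearisation` (c2),
# stub `stub_heptagonalDehnZero`: the heptagonal relation — Gauss period, positivity, Dehn invariant

Let `ζ = e^{2πi/7}`, `x = (1+√−7)/2`, `y = (−1+√−7)/4`. Numerically `7(D(ζ)+D(ζ²)−D(ζ³)) = 8D(x) + 4D(y)` for the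
Bloch–Wigner dilogarithm; the lead's `stub_heptagonalRelation` certifies the corresponding formal combination
`β₇ = 7[ζ]+7[ζ²]−7[ζ³]−8[x]−4[y]` modulo Borel–Suslin. This file supplies two of the inputs:

§1 (worker W1) the quadratic Gauss period `ζ + ζ² + ζ⁴ = (−1 + √−7)/2` (so `x = 1+ζ+ζ²+ζ⁴`, `y = (ζ+ζ²+ζ⁴)/2`
are cyclotomic) and positivity of the five imaginary parts; §2 (worker W2) the Dehn invariant `dehn u v β₇`
vanishes for EVERY pair of `ℚ`-characters `u, v` of `ℂˣ` (roots of unity have torsion symbol; `1 − x = x̄`,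
`y = −1/x`, `1 − y = −x̄²/x`, so `x ∧ (1−x) = x ∧ x̄` and `y ∧ (1−y) = −2·x ∧ x̄`, total `8·1 + 4·(−2) = 0`).
Sorry-free; axioms ⊆ {propext, Classical.choice, Quot.sound}.
-/

noncomputable section

open scoped BigOperators ComplexConjugate

namespace Summit.KontsevichZagierPeriods.HyperbolicBloch.ZagierDilogarithmGaloisDescent

open Summit.KontsevichZagierPeriods.HyperbolicBloch.ZagierDilogarithmConjectureNegative
  (ext ext_of_ne ext_mul ext_one ext_inv ext_div ext_neg ext_neg_one ext_eq_zero_of_pow_eq_one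
    sym asym dehn dehn_of)
open Summit.KontsevichZagierPeriods.HyperbolicBloch.ZagierDilogarithm
  (sym_eq_zero_of_pow_eq_one asym_eq_zero_of_pow_eq_one)

/-! ## §1 The Gauss period and positivity (W1) -/


/-- `exp(2πi/7)` is a primitive `7`-th root of unity (`Complex.isPrimitiveRoot_exp`). [folklore] -/
theorem hept_W1_isPrimitiveRoot :
    IsPrimitiveRoot (Complex.exp (2 * Real.pi * Complex.I / 7)) 7 := by
  simpa using Complex.isPrimitiveRoot_exp 7 (by norm_num)

/-- Powers of `ζ = exp(2πi/7)` as exponentials of a real multiple of `i`: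
`ζ ^ k = exp((2πk/7)·i)`. [folklore] -/
theorem hept_W1_pow_eq (k : ℕ) :
    Complex.exp (2 * Real.pi * Complex.I / 7) ^ k =
      Complex.exp (((2 * Real.pi * k / 7 : ℝ) : ℂ) * Complex.I) := by
  rw [← Complex.exp_nat_mul]
  congr 1
  push_cast
  ring

/-- Imaginary parts of the powers of `ζ = exp(2πi/7)`: `Im ζ ^ k = sin(2πk/7)`. [folklore] -/
theorem hept_W1_pow_im (k : ℕ) :
    (Complex.exp (2 * Real.pi * Complex.I / 7) ^ k).im = Real.sin (2 * Real.pi * k / 7) := by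
  rw [hept_W1_pow_eq, Complex.exp_ofReal_mul_I_im]

/-- `Im ζ = sin(2π/7)` for `ζ = exp(2πi/7)`. [folklore] -/
theorem hept_W1_im_one :
    (Complex.exp (2 * Real.pi * Complex.I / 7)).im = Real.sin (2 * Real.pi / 7) := by
  simpa using hept_W1_pow_im 1

/-- `Im ζ² = sin(4π/7)` for `ζ = exp(2πi/7)`. [folklore] -/
theorem hept_W1_im_two :
    (Complex.exp (2 * Real.pi * Complex.I / 7) ^ 2).im = Real.sin (4 * Real.pi / 7) := by
  rw [hept_W1_pow_im]; congr 1; push_cast; ring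

/-- `Im ζ³ = sin(6π/7)` for `ζ = exp(2πi/7)`. [folklore] -/
theorem hept_W1_im_three :
    (Complex.exp (2 * Real.pi * Complex.I / 7) ^ 3).im = Real.sin (6 * Real.pi / 7) := by
  rw [hept_W1_pow_im]; congr 1; push_cast; ring

/-- `Im ζ⁴ = sin(8π/7) = −sin(π/7)` for `ζ = exp(2πi/7)`. [folklore] -/
theorem hept_W1_im_four :
    (Complex.exp (2 * Real.pi * Complex.I / 7) ^ 4).im = -Real.sin (Real.pi / 7) := by
  rw [hept_W1_pow_im, ← Real.sin_add_pi]; congr 1; push_cast; ring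

/-- `sin(2π/7) > 0`. [folklore] -/
theorem hept_W1_sin_two_pos : 0 < Real.sin (2 * Real.pi / 7) :=
  Real.sin_pos_of_pos_of_lt_pi (by positivity) (by linarith [Real.pi_pos])

/-- `sin(4π/7) > 0`. [folklore] -/
theorem hept_W1_sin_four_pos : 0 < Real.sin (4 * Real.pi / 7) :=
  Real.sin_pos_of_pos_of_lt_pi (by positivity) (by linarith [Real.pi_pos])

/-- `sin(6π/7) > 0`. [folklore] -/
theorem hept_W1_sin_six_pos : 0 < Real.sin (6 * Real.pi / 7) :=
  Real.sin_pos_of_pos_of_lt_pi (by positivity) (by linarith [Real.pi_pos])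

/-- `sin(π/7) < sin(2π/7)` (`sin` is increasing on `[−π/2, π/2]`). [folklore] -/
theorem hept_W1_sin_one_lt_sin_two : Real.sin (Real.pi / 7) < Real.sin (2 * Real.pi / 7) :=
  Real.sin_lt_sin_of_lt_of_le_pi_div_two (by linarith [Real.pi_pos]) (by linarith [Real.pi_pos])
    (by linarith [Real.pi_pos])

/-- The Gauss period `η = ζ + ζ² + ζ⁴` (`ζ = exp(2πi/7)`) has positive imaginary part:
`Im η = sin(2π/7) + sin(4π/7) − sin(π/7) > 0`. [folklore] -/
theorem hept_W1_gaussPeriod_im_pos :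
    0 < (Complex.exp (2 * Real.pi * Complex.I / 7) + Complex.exp (2 * Real.pi * Complex.I / 7) ^ 2 +
        Complex.exp (2 * Real.pi * Complex.I / 7) ^ 4).im := by
  rw [Complex.add_im, Complex.add_im, hept_W1_im_one, hept_W1_im_two, hept_W1_im_four]
  linarith [hept_W1_sin_two_pos, hept_W1_sin_four_pos, hept_W1_sin_one_lt_sin_two]

/-- The Gauss period `η = ζ + ζ² + ζ⁴` (`ζ = exp(2πi/7)`) satisfies `η² + η + 2 = 0`
(from `ζ⁷ = 1` and `1 + ζ + ⋯ + ζ⁶ = 0`). [folklore] -/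
theorem hept_W1_gaussPeriod_quadratic :
    (Complex.exp (2 * Real.pi * Complex.I / 7) + Complex.exp (2 * Real.pi * Complex.I / 7) ^ 2 +
        Complex.exp (2 * Real.pi * Complex.I / 7) ^ 4) ^ 2 +
      (Complex.exp (2 * Real.pi * Complex.I / 7) + Complex.exp (2 * Real.pi * Complex.I / 7) ^ 2 +
        Complex.exp (2 * Real.pi * Complex.I / 7) ^ 4) + 2 = 0 := by
  have hζ := hept_W1_isPrimitiveRoot
  generalize Complex.exp (2 * Real.pi * Complex.I / 7) = ζ at hζ ⊢
  have h7 : ζ ^ 7 = 1 := hζ.pow_eq_one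
  have hS : (Finset.range 7).sum (fun i => ζ ^ i) = 0 := hζ.geom_sum_eq_zero (by norm_num)
  simp only [Finset.sum_range_succ, Finset.sum_range_zero, zero_add, pow_zero, pow_one] at hS
  linear_combination ζ * h7 + 2 * hS

/-- **Quadratic Gauss period of conductor `7`.** For `ζ = exp(2πi/7)`,
`ζ + ζ² + ζ⁴ = (−1 + √7·i)/2`, i.e. `√−7 = 1 + 2(ζ + ζ² + ζ⁴) ∈ ℚ(ζ₇)` with the sign fixed by the
standard embedding. Proof: `η² + η + 2 = 0` gives `(2η + 1)² = (√7·i)²`, and `Im η > 0` excludes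
`2η + 1 = −√7·i`. [folklore] -/
theorem hept_gaussPeriod :
    Complex.exp (2 * Real.pi * Complex.I / 7) + Complex.exp (2 * Real.pi * Complex.I / 7) ^ 2 +
        Complex.exp (2 * Real.pi * Complex.I / 7) ^ 4 = (-1 + (Real.sqrt 7 : ℂ) * Complex.I) / 2 := by
  have hq := hept_W1_gaussPeriod_quadratic
  have him := hept_W1_gaussPeriod_im_pos
  generalize Complex.exp (2 * Real.pi * Complex.I / 7) +
      Complex.exp (2 * Real.pi * Complex.I / 7) ^ 2 +
        Complex.exp (2 * Real.pi * Complex.I / 7) ^ 4 = η at hq him ⊢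
  have h7 : ((Real.sqrt 7 : ℂ) * Complex.I) ^ 2 = -7 := by
    rw [mul_pow, Complex.I_sq, ← Complex.ofReal_pow, Real.sq_sqrt (by norm_num)]
    push_cast
    ring
  have hsq : (2 * η + 1) ^ 2 = ((Real.sqrt 7 : ℂ) * Complex.I) ^ 2 := by
    rw [h7]
    linear_combination 4 * hq
  rcases sq_eq_sq_iff_eq_or_eq_neg.1 hsq with h | h
  · linear_combination h / 2
  · exfalso
    have h' := congrArg Complex.im h
    simp only [Complex.add_im, Complex.mul_im, Complex.neg_im, Complex.ofReal_re,
      Complex.ofReal_im, Complex.I_re, Complex.I_im, Complex.re_ofNat, Complex.im_ofNat,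
      Complex.one_im] at h'
    have hs : 0 < Real.sqrt 7 := Real.sqrt_pos.2 (by norm_num)
    linarith

/-- **Upper-half-plane positivity of the five heptagonal points.** Each of
`ζ, ζ², ζ³, x = (1 + √7·i)/2, y = (−1 + √7·i)/4` (`ζ = exp(2πi/7)`) has positive imaginary part:
`sin(2π/7), sin(4π/7), sin(6π/7) > 0` and `√7/2, √7/4 > 0`. [folklore] -/
theorem hept_im_pos : ∀ i : Fin 5,
    0 < ((![Complex.exp (2 * Real.pi * Complex.I / 7), Complex.exp (2 * Real.pi * Complex.I / 7) ^ 2,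
      Complex.exp (2 * Real.pi * Complex.I / 7) ^ 3, (1 + (Real.sqrt 7 : ℂ) * Complex.I) / 2,
      (-1 + (Real.sqrt 7 : ℂ) * Complex.I) / 4] : Fin 5 → ℂ) i).im := by
  intro i
  fin_cases i
  · simpa [hept_W1_im_one] using hept_W1_sin_two_pos
  · simpa [hept_W1_im_two] using hept_W1_sin_four_pos
  · simpa [hept_W1_im_three] using hept_W1_sin_six_pos
  · simp [Complex.div_ofNat_im]
  · simp [Complex.div_ofNat_im]


/-! ## §2 The Dehn invariant vanishes (W2) -/



/-- The symbol `s(z) = u(z)v(1 − z) − v(z)u(1 − z)` is odd under `z ↦ 1 − z`: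
`s(1 − z) = −s(z)`. [folklore] -/
theorem hept_W2_sym_one_sub (u v : Additive ℂˣ →+ ℚ) (z : ℂ) :
    sym u v (1 - z) = -sym u v z := by
  simp only [sym, sub_sub_cancel]
  ring

/-- For `z ∉ {0, 1}` with `z(1 − z) = 2` (i.e. `z = (1 ± √7·i)/2`) one has
`1 + z⁻¹ = −(1 − z)²·z⁻¹`, hence `u(−z⁻¹) = −u(z)`, `u(1 + z⁻¹) = 2u(1 − z) − u(z)` and
`s(−z⁻¹) = −2·s(z)`. [folklore] -/
theorem hept_W2_sym_neg_inv (u v : Additive ℂˣ →+ ℚ) {z : ℂ} (hz0 : z ≠ 0) (hz1 : z ≠ 1)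
    (hz : z * (1 - z) = 2) : sym u v (-z⁻¹) = -2 * sym u v z := by
  have h1z : 1 - z ≠ 0 := sub_ne_zero.mpr (Ne.symm hz1)
  have hsq : (1 - z) ^ 2 = -(z + 1) := by linear_combination (-1 : ℂ) * hz
  have key : 1 - -z⁻¹ = -((1 - z) ^ 2 * z⁻¹) := by
    rw [hsq, neg_mul, neg_neg, add_mul, mul_inv_cancel₀ hz0]
    ring
  have e1 : ∀ w : Additive ℂˣ →+ ℚ, ext w (-z⁻¹) = -ext w z := fun w => by
    rw [ext_neg w (inv_ne_zero hz0), ext_inv w hz0]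
  have e2 : ∀ w : Additive ℂˣ →+ ℚ, ext w (1 - -z⁻¹) = 2 * ext w (1 - z) - ext w z := fun w => by
    rw [key, ext_neg w (mul_ne_zero (pow_ne_zero 2 h1z) (inv_ne_zero hz0)),
      ext_mul w (pow_ne_zero 2 h1z) (inv_ne_zero hz0), pow_two, ext_mul w h1z h1z, ext_inv w hz0]
    ring
  simp only [sym]
  rw [e1 u, e1 v, e2 u, e2 v]
  ring

/-- The point `x = (1 + √7·i)/2` satisfies `x(1 − x) = 2` (`(√7)² = 7`, `i² = −1`). [folklore] -/
theorem hept_W2_x_mul_one_sub :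
    (1 + (Real.sqrt 7 : ℂ) * Complex.I) / 2 * (1 - (1 + (Real.sqrt 7 : ℂ) * Complex.I) / 2) =
      2 := by
  have hs : ((Real.sqrt 7 : ℝ) : ℂ) ^ 2 = 7 := by
    rw [← Complex.ofReal_pow, Real.sq_sqrt (by norm_num : (0 : ℝ) ≤ 7)]
    norm_num
  linear_combination (1 / 4 : ℂ) * hs - ((Real.sqrt 7 : ℂ) ^ 2 / 4) * Complex.I_sq

/-- Complex conjugation swaps the two roots of `z² − z + 2`: `conj x = 1 − x` for
`x = (1 + √7·i)/2`. [folklore] -/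
theorem hept_W2_conj_x :
    conj ((1 + (Real.sqrt 7 : ℂ) * Complex.I) / 2) =
      1 - (1 + (Real.sqrt 7 : ℂ) * Complex.I) / 2 := by
  simp only [map_div₀, map_add, map_one, map_mul, Complex.conj_ofReal, Complex.conj_I, map_ofNat]
  ring

/-- `x = (1 + √7·i)/2` is non-zero (as `x(1 − x) = 2`). [folklore] -/
theorem hept_W2_x_ne_zero : (1 + (Real.sqrt 7 : ℂ) * Complex.I) / 2 ≠ 0 := by
  intro h
  have e := hept_W2_x_mul_one_sub
  rw [h, zero_mul] at e
  norm_num at e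

/-- `x = (1 + √7·i)/2` is not `1` (as `x(1 − x) = 2`). [folklore] -/
theorem hept_W2_x_ne_one : (1 + (Real.sqrt 7 : ℂ) * Complex.I) / 2 ≠ 1 := by
  intro h
  have e := hept_W2_x_mul_one_sub
  rw [h, sub_self, mul_zero] at e
  norm_num at e

/-- `y = (−1 + √7·i)/4 = −x⁻¹` for `x = (1 + √7·i)/2` (since `x⁻¹ = (1 − x)/2`). [folklore] -/
theorem hept_W2_y_eq :
    (-1 + (Real.sqrt 7 : ℂ) * Complex.I) / 4 = -((1 + (Real.sqrt 7 : ℂ) * Complex.I) / 2)⁻¹ := by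
  have hinv : ((1 + (Real.sqrt 7 : ℂ) * Complex.I) / 2)⁻¹ =
      (1 - (1 + (Real.sqrt 7 : ℂ) * Complex.I) / 2) / 2 := by
    refine inv_eq_of_mul_eq_one_right ?_
    rw [mul_div_assoc', hept_W2_x_mul_one_sub, div_self two_ne_zero]
  rw [hinv]
  ring

/-- **W2 (Dehn invariant of the heptagonal relation vanishes).** For `ζ = e^{2πi/7}`,
`x = (1 + √7·i)/2`, `y = (−1 + √7·i)/4` and every pair of additive characters `u, v : ℂˣ → ℚ`,
the Dehn-type invariant `dehn u v` of `7[ζ] + 7[ζ²] − 7[ζ³] − 8[x] − 4[y]` is zero: roots of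
unity contribute nothing, `asym x = 2·s(x)` and `asym y = −4·s(x)`. [folklore] -/
theorem hept_dehn_zero : ∀ u v : Additive ℂˣ →+ ℚ,
    dehn u v (∑ i : Fin 5, (![7, 7, -7, -8, -4] : Fin 5 → ℤ) i •
      FreeAbelianGroup.of ((![Complex.exp (2 * Real.pi * Complex.I / 7),
        Complex.exp (2 * Real.pi * Complex.I / 7) ^ 2,
        Complex.exp (2 * Real.pi * Complex.I / 7) ^ 3, (1 + (Real.sqrt 7 : ℂ) * Complex.I) / 2,
        (-1 + (Real.sqrt 7 : ℂ) * Complex.I) / 4] : Fin 5 → ℂ) i)) = 0 := by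
  intro u v
  -- the cyclotomic points
  have hprim : IsPrimitiveRoot (Complex.exp (2 * Real.pi * Complex.I / 7)) 7 := by
    simpa using Complex.isPrimitiveRoot_exp 7 (by norm_num)
  have h7 : Complex.exp (2 * Real.pi * Complex.I / 7) ^ 7 = 1 := hprim.pow_eq_one
  have hk : ∀ k : ℕ, (Complex.exp (2 * Real.pi * Complex.I / 7) ^ k) ^ 7 = 1 := fun k => by
    rw [← pow_mul, pow_mul', h7, one_pow]
  have a1 : asym u v (Complex.exp (2 * Real.pi * Complex.I / 7)) = 0 :=
    asym_eq_zero_of_pow_eq_one u v (by norm_num) h7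
  have a2 : asym u v (Complex.exp (2 * Real.pi * Complex.I / 7) ^ 2) = 0 :=
    asym_eq_zero_of_pow_eq_one u v (by norm_num) (hk 2)
  have a3 : asym u v (Complex.exp (2 * Real.pi * Complex.I / 7) ^ 3) = 0 :=
    asym_eq_zero_of_pow_eq_one u v (by norm_num) (hk 3)
  -- the `√7`-points, all through `x`
  have hx0 := hept_W2_x_ne_zero
  have hx1 := hept_W2_x_ne_one
  have hx := hept_W2_x_mul_one_sub
  have hcx := hept_W2_conj_x
  have h1x0 : 1 - (1 + (Real.sqrt 7 : ℂ) * Complex.I) / 2 ≠ 0 := sub_ne_zero.mpr (Ne.symm hx1)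
  have h1x1 : 1 - (1 + (Real.sqrt 7 : ℂ) * Complex.I) / 2 ≠ 1 := fun e => hx0 (by
    rwa [sub_eq_self] at e)
  have h1x : (1 - (1 + (Real.sqrt 7 : ℂ) * Complex.I) / 2) *
      (1 - (1 - (1 + (Real.sqrt 7 : ℂ) * Complex.I) / 2)) = 2 := by
    rw [sub_sub_cancel, mul_comm, hx]
  have ax : asym u v ((1 + (Real.sqrt 7 : ℂ) * Complex.I) / 2) =
      2 * sym u v ((1 + (Real.sqrt 7 : ℂ) * Complex.I) / 2) := by
    rw [asym, hcx, hept_W2_sym_one_sub]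
    ring
  have ay : asym u v ((-1 + (Real.sqrt 7 : ℂ) * Complex.I) / 4) =
      -4 * sym u v ((1 + (Real.sqrt 7 : ℂ) * Complex.I) / 2) := by
    rw [asym, hept_W2_y_eq, map_neg, map_inv₀, hcx, hept_W2_sym_neg_inv u v hx0 hx1 hx,
      hept_W2_sym_neg_inv u v h1x0 h1x1 h1x, hept_W2_sym_one_sub]
    ring
  simp only [map_add, map_zsmul, dehn_of, Fin.sum_univ_five, Matrix.cons_val, a1, a2, a3, ax, ay,
    smul_zero, zero_add]
  simp only [zsmul_eq_mul]
  push_cast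
  ring


/-- **Registered stub `stub_heptagonalDehnZero`** (= `hept_dehn_zero`): every Dehn invariant of `β₇` vanishes.
[folklore] -/
theorem stub_heptagonalDehnZero :
    ∀ u v : Additive ℂˣ →+ ℚ,
    dehn u v (∑ i : Fin 5, (![7, 7, -7, -8, -4] : Fin 5 → ℤ) i •
      FreeAbelianGroup.of ((![Complex.exp (2 * Real.pi * Complex.I / 7),
        Complex.exp (2 * Real.pi * Complex.I / 7) ^ 2,
        Complex.exp (2 * Real.pi * Complex.I / 7) ^ 3, (1 + (Real.sqrt 7 : ℂ) * Complex.I) / 2,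
        (-1 + (Real.sqrt 7 : ℂ) * Complex.I) / 4] : Fin 5 → ℂ) i)) = 0 :=
  hept_dehn_zero

end Summit.KontsevichZagierPeriods.HyperbolicBloch.ZagierDilogarithmGaloisDescent

end
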